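import Summits.ABC.ABC.Theses.PadicPrincipalCoreST86
import Summits.ABC.StewartYu.PrimePadicSocketOdd
import HarnessLib

/-!
# Route PadicPrincipalCoreST86, item `OddShapeSpec`: closed by the cell's odd-prime socket

`Summits/ABC/ABC/Theorems/PadicPrincipalCoreST86OddShape.lean` — cell `abc-stewartyu`, seat p3.
The support item `OddShapeSpec` (the one-prime bound at the odd primes alone, `K ≥ 0`, `L ≥ 1`,
`κ, σ ≥ 0`, gives `BakerShapeBound θ 0` for every `θ ≥ κ + σ + 1`) is the landed
`Summit.ABC.StewartYu.bakerShapeBound_of_oddPrime_logRadShape` followed by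
`Summit.ABC.StewartYu.bakerShapeBound_zero_mono`.
-/

set_option linter.dupNamespace false

namespace Summit.ABC.ABC.Theorems

/-- **Item `OddShapeSpec` of route PadicPrincipalCoreST86.** [folklore] -/
theorem padicPrincipalCoreST86_oddShapeSpec_proof :
    Summit.ABC.ABC.Theses.PadicPrincipalCoreST86.OddShapeSpec := by
  unfold Summit.ABC.ABC.Theses.PadicPrincipalCoreST86.OddShapeSpec
  intro K L κ σ θ τ τ₁ hK hL hκ0 hσ0 hθ h
  exact Summit.ABC.StewartYu.bakerShapeBound_zero_mono hθ
    (Summit.ABC.StewartYu.bakerShapeBound_of_oddPrime_logRadShape hK hL hκ0 hσ0 h)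

end Summit.ABC.ABC.Theorems
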